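import Literature.Topology.FourManifolds.TautFoliationsCollarLeaf
import Literature.Topology.PlanarFoliations.VertSidesPlaque
import HarnessLib

/-!
# The centre lies inside the essential compact contour leaf of the coned collar

Topic: the coned fence collar, V-process set-up (α). With the data of the collar (even mesh,
generic radius `R`, `y₀ = ringParam c₀ R 0 = c₀ + (R, 0)` on the horizontal grid line through
`c₀`), let `E₀` be the compact contour leaf through `y₀`. **The centre `c₀` lies in the inner
Jordan domain of `E₀`** (`centre_mem_insideLeaf`): the horizontal line through `c₀` meets the
wiggly ring `W_R ⊇ E₀` only at the two ring points `c₀ ± (R, 0)` (a point of `W_R` on a grid line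
is on the boundary of its square, hence a ring point); the half-line `{c₀ + (t, 0) : t > R}` is
connected, off `E₀` and unbounded, hence outer; in the flow box of the contour foliation at `y₀`
(an edge chart) the heights of the nearby line points `c₀ + (t, 0)` are a strictly monotone
function of `t` (they read the radial height of the ring square), so points just left and just
right of `y₀` are on different sides of `E₀` (`VertSidesPlaque`); thus the segment
`{c₀ + (t, 0) : -R < t < R} ∋ c₀`, connected and off `E₀`, is inner.

* `mem_sphere_of_mem_sq_of_snd_eq`, `dist_eq_of_mem_wigglyRing_of_snd_eq`, `renormBox_snd_lt_iff'`
  (deprecated alias of `PlanarFoliations.renormBox_snd_lt_iff`),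
  `centre_mem_insideLeaf` (**proved**).

All statements are [folklore].
-/

noncomputable section

open Set Filter Metric Topology Function Real
open scoped unitInterval
open Literature.Topology.PlanarFoliations

namespace Literature.Topology.FourManifolds

namespace Foliation.ConePosition

open SquareGrid SquareGrid.Grid SquarePolar ConeSquare CollarRadius Partition

variable {B : Type*} [NormedAddCommGroup B] [NormedSpace ℝ B] {M : Type*} [TopologicalSpace M] {F : Foliation B M}
variable {Γ : C(I, F.GermSpace)} {τ₀ ε : ℝ} {Φ : I → ℝ → M} {c₀ : ℝ × ℝ} {L : ℝ} {hL : 0 < L} {G : ℝ × ℝ → M}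
variable (P : ConePosition F G c₀ hL)

omit [NormedSpace ℝ B] in
/-- **For an even mesh, a point of a closed square on the horizontal line through `c₀` is on the
boundary of the square.** [folklore] -/
theorem mem_sphere_of_mem_sq_of_snd_eq (heven : Even P.n) {q : Fin P.n × Fin P.n} {x : ℝ × ℝ} (hq : x ∈ P.gr.sq q)
    (hx2 : x.2 = c₀.2) : x ∈ sphere (P.gr.centre q) P.gr.ℓ := by
  have hℓpos := P.gr.hℓ
  obtain ⟨hc, hnl⟩ := grid_bigCentre (c₀ := c₀) hL P.hn
  refine (P.gr.mem_sphere_centre_iff).2 ⟨hq, ?_⟩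
  obtain ⟨k, hk⟩ := heven
  have hc2 : c₀.2 = P.gr.a.2 + 2 * (k : ℝ) * P.gr.ℓ := by
    have h1 : c₀.2 = P.gr.bigCentre.2 := by rw [hc]
    have h2 : P.gr.bigCentre.2 = P.gr.a.2 + P.gr.n * P.gr.ℓ := rfl
    have h3 : (P.gr.n : ℝ) = 2 * k := by
      have : P.gr.n = P.n := rfl
      rw [this, hk]; push_cast; ring
    rw [h1, h2, h3]
  have hsq := (P.gr.mem_sq_iff).1 hq
  have h3 := hsq.2.2.1; have h4 := hsq.2.2.2
  rw [hx2, hc2] at h3 h4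
  have hk1 : ((q.2 : ℕ) : ℝ) ≤ k := by nlinarith
  have hk2 : (k : ℝ) ≤ (q.2 : ℕ) + 1 := by nlinarith
  have hk1' : (q.2 : ℕ) ≤ k := by exact_mod_cast hk1
  have hk2' : k ≤ (q.2 : ℕ) + 1 := by exact_mod_cast hk2
  rcases Nat.eq_or_lt_of_le hk1' with h | h
  · right; right; left
    rw [hx2, hc2, ← h]
  · have hkeq : k = (q.2 : ℕ) + 1 := le_antisymm hk2' h
    right; right; right
    rw [hx2, hc2, hkeq]; push_cast; ring

variable (hΦ : IsFenceOn F Γ τ₀ ε Φ univ) (hcl : ∀ τ ∈ Ioo (τ₀ - ε) (τ₀ + ε), Φ 1 τ = Φ 0 τ) {τ₁ : ℝ}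
  (hτI : uIcc τ₀ τ₁ ⊆ Ioo (τ₀ - ε) (τ₀ + ε)) (h01 : τ₁ ≠ τ₀)
  (hG : ∀ x, L / 2 ≤ dist x c₀ → G x = Φ (angleParam c₀ x) (levelOfParam τ₀ τ₁ (1 - dist x c₀ / L)))
  (hGc : Continuous G) (hn32 : 32 ≤ P.n)
  (hskelT : ∀ q k, P.gr.edge q k '' Icc 0 (2 * P.gr.ℓ) ⊆ {x | 7 * L / 8 ≤ dist x c₀} →
    ∀ s ∈ Icc 0 (2 * P.gr.ℓ), P.skel (P.gr.edge q k s) = G (P.gr.edge q k s))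
  {R : ℝ} (hR : 15 * L / 16 ≤ R)

include hΦ hcl hτI h01 hG hGc hn32 hskelT hR in
omit [NormedSpace ℝ B] in
/-- **The wiggly ring meets the horizontal line through `c₀` only at ring points** (even mesh).
[folklore] -/
theorem dist_eq_of_mem_wigglyRing_of_snd_eq (heven : Even P.n) {x : ℝ × ℝ} (hx : x ∈ P.wigglyRing R) (hx2 : x.2 = c₀.2) :
    dist x c₀ = R := by
  obtain ⟨q, hqR, hxq⟩ := mem_iUnion₂.1 hx
  exact P.dist_eq_of_mem_ringLevel_of_mem_sphere hΦ hcl hτI h01 hG hGc hn32 hskelT hR hqR hxq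
    (P.mem_sphere_of_mem_sq_of_snd_eq heven hxq.1 hx2)

/-- Strict order of heights through a renormalised chart — duplicate of
`Literature.Topology.PlanarFoliations.renormBox_snd_lt_iff` (`PlanarFoliations/Renorm.lean`),
kept as a deprecated alias (librarian dedup-01417). [folklore] -/
@[deprecated Literature.Topology.PlanarFoliations.renormBox_snd_lt_iff (since := "2026-08-16")]
alias renormBox_snd_lt_iff' := Literature.Topology.PlanarFoliations.renormBox_snd_lt_iff

include hΦ hcl hτI h01 hG hGc hn32 hskelT hR in
/-- **The centre `c₀` lies in the inner Jordan domain of the compact contour leaf through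
`y₀ = c₀ + (R, 0)`** (even mesh, generic radius). [folklore] -/
theorem centre_mem_insideLeaf (ho : F.IsTransverselyOriented) (hvert : ∀ v ∈ P.gr.vertices, dist v c₀ ≠ R)
    (hRL : R + 2 * P.gr.ℓ < L) (heven : Even P.n) (hy₀X : ringParam c₀ R 0 ∈ (P.gr.X₀ : Set (ℝ × ℝ))) :
    Complex.equivRealProdCLM.symm c₀ ∈
      insideLeaf (P.contourFol ho) P.gr.planeEmb (⟨ringParam c₀ R 0, hy₀X⟩ : P.gr.X₀) := by
  classical
  have hL' : 0 < L := hL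
  have hℓ := P.gr.hℓ
  have hR0 : 0 < R := by linarith
  haveI := P.gr.nonempty_X₀
  set Fc := P.contourFol ho with hFc
  set ι : P.gr.X₀ → ℂ := P.gr.planeEmb with hιdef
  have hι : IsOpenEmbedding ι := P.gr.isOpenEmbedding_planeEmb
  have hbi : IsBiOriented Fc := P.isBiOriented_contourFol ho
  set toCC : ℝ × ℝ → ℂ := fun x ↦ Complex.equivRealProdCLM.symm x with htoCC
  have htoCCc : Continuous toCC := Complex.equivRealProdCLM.symm.continuous
  have hιapp : ∀ z : P.gr.X₀, ι z = toCC (z : ℝ × ℝ) := fun z ↦ rfl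
  have htoCCinj : Injective toCC := Complex.equivRealProdCLM.symm.injective
  set y₀ : P.gr.X₀ := ⟨ringParam c₀ R 0, hy₀X⟩ with hy₀
  have hy₀eq : (y₀ : ℝ × ℝ) = c₀ + ((R, 0) : ℝ × ℝ) := ringParam_zero
  -- the leaf: compact, in the wiggly ring
  have hWX := P.wigglyRing_subset_X₀ hΦ hcl hτI h01 hG hGc hn32 hskelT hR hvert hRL
  have hy₀sk : ringParam c₀ R 0 ∈ P.gr.skeleton := P.ringParam_zero_mem_skeleton heven hR0.le (by linarith)
  obtain ⟨qy, hqy⟩ := (P.gr.mem_skeleton_iff).1 hy₀sk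
  have hy₀W : (y₀ : ℝ × ℝ) ∈ P.wigglyRing R :=
    P.mem_wigglyRing_of_mem_sphere hΦ hcl hτI h01 hG hGc hn32 hskelT hR hqy (dist_ringParam hR0.le 0)
  have hEc : IsCompact (Fc.leaf y₀) := P.isCompact_leaf_of_mem_wigglyRing hΦ hcl hτI h01 hG hGc hn32 hskelT hR ho hvert hRL y₀ hy₀W
  have hEW : ∀ z ∈ Fc.leaf y₀, (z : ℝ × ℝ) ∈ P.wigglyRing R := P.leaf_subset_wigglyRing hΦ hcl hτI h01 hG hGc hn32 hskelT hR ho hy₀W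
  -- the points of the horizontal line through `c₀`
  set pt : ℝ → ℝ × ℝ := fun t ↦ c₀ + ((t, 0) : ℝ × ℝ) with hpt
  have hptc : Continuous pt := continuous_const.add (continuous_id.prodMk continuous_const)
  have hpt2 : ∀ t, (pt t).2 = c₀.2 := fun t ↦ by simp [hpt]
  have hptd : ∀ t, dist (pt t) c₀ = |t| := fun t ↦ by
    rw [Prod.dist_eq, Real.dist_eq, Real.dist_eq]; simp [hpt]
  have hpt0 : pt 0 = c₀ := by simp [hpt]
  have hptR : pt R = (y₀ : ℝ × ℝ) := by rw [hy₀eq]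
  -- off the two ring points, the line avoids the image of the leaf
  have hoff : ∀ t, |t| ≠ R → toCC (pt t) ∉ ι '' Fc.leaf y₀ := by
    rintro t ht ⟨z, hz, hzt⟩
    rw [hιapp] at hzt
    have hzeq : (z : ℝ × ℝ) = pt t := htoCCinj hzt
    have h := P.dist_eq_of_mem_wigglyRing_of_snd_eq hΦ hcl hτI h01 hG hGc hn32 hskelT hR heven (hEW z hz) (by rw [hzeq, hpt2])
    rw [hzeq, hptd] at h
    exact ht h
  -- the outer half-line
  obtain ⟨hUo, hVo, hUc, hVc, hfU, hfV, hUb, hVb⟩ := insideLeaf_spec (ι := ι) hbi hι hEc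
  have hBout : ∀ t, R < t → toCC (pt t) ∈ outsideLeaf Fc ι y₀ := by
    -- a far point of the half-line is outer, and the half-line is connected and off the leaf
    obtain ⟨C, hC⟩ := hUb.subset_closedBall 0
    set t₁ := max (R + 1) (C + |c₀.1| + 1) with ht₁
    have ht₁R : R < t₁ := lt_of_lt_of_le (by linarith) (le_max_left _ _)
    have hfar : toCC (pt t₁) ∉ insideLeaf Fc ι y₀ := fun h ↦ by
      have h1 := hC h
      rw [mem_closedBall, dist_zero_right] at h1
      have h2 : |(toCC (pt t₁)).re| ≤ ‖toCC (pt t₁)‖ := Complex.abs_re_le_norm _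
      have h3 : (toCC (pt t₁)).re = c₀.1 + t₁ := by simp [htoCC, hpt]
      rw [h3] at h2
      have h4 : C + |c₀.1| + 1 ≤ t₁ := le_max_right _ _
      have h5 : t₁ - |c₀.1| ≤ |c₀.1 + t₁| := by
        have := abs_add_le (c₀.1 + t₁) (-c₀.1); rw [abs_neg] at this
        have h' : c₀.1 + t₁ + -c₀.1 = t₁ := by ring
        rw [h'] at this
        have ht₁0 : 0 ≤ t₁ := by linarith [abs_nonneg c₀.1]
        rw [abs_of_nonneg ht₁0] at this; linarith
      linarith
    have hfarout : toCC (pt t₁) ∈ outsideLeaf Fc ι y₀ := by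
      rcases mem_insideLeaf_or_mem_outsideLeaf (hoff t₁ (by rw [abs_of_pos (by linarith)]; exact ht₁R.ne')) with h | h
      · exact absurd h hfar
      · exact h
    have hBc : IsPreconnected (toCC ∘ pt '' Ioi R) := isPreconnected_Ioi.image _ (htoCCc.comp hptc).continuousOn
    have hBK : Disjoint (toCC ∘ pt '' Ioi R) (ι '' Fc.leaf y₀) := disjoint_left.2 (by
      rintro _ ⟨t, ht, rfl⟩ h
      exact hoff t (by rw [abs_of_pos (hR0.trans ht)]; exact (ne_of_gt ht)) h)
    intro t ht
    exact subset_outsideLeaf_of_isPreconnected hbi hι hEc hBc hBK ⟨_, ⟨t₁, ht₁R, rfl⟩, hfarout⟩ ⟨t, ht, rfl⟩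
  /- the flow box of the contour foliation at `y₀`: an edge chart -/
  obtain ⟨d, hd, hy₀d⟩ := Fc.exists_mem_source y₀
  have hdA := hd
  obtain ⟨d₀, hd₀, rfl⟩ := hd
  obtain ⟨c, hc, p, r, hr, hbox, rfl⟩ := hd₀
  obtain ⟨ĉ, hĉ, rfl⟩ := hc
  have hsrc : ∀ z : P.gr.X₀, z ∈ (orientChart P.gr.planeEmb (renormBox (ĉ.subtypeRestr P.gr.nonempty_X₀) p r hr)).source →
      z ∈ (renormBox (ĉ.subtypeRestr P.gr.nonempty_X₀) p r hr).source ∧ (z : ℝ × ℝ) ∈ ĉ.source := fun z hz ↦ by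
    rw [orientChart_source] at hz
    refine ⟨hz, ?_⟩
    have h := renormBox_source_subset _ _ _ _ hz
    rwa [OpenPartialHomeomorph.subtypeRestr_source] at h
  obtain ⟨hy₀r, hy₀ĉ⟩ := hsrc y₀ hy₀d
  -- `y₀` is not in an open square
  have hy₀nb : ∀ q, (y₀ : ℝ × ℝ) ∉ ball (P.gr.centre q) P.gr.ℓ := fun q hb ↦ by
    have hs := P.mem_sphere_of_mem_skeleton_of_mem_sq hy₀sk (ball_subset_closedBall hb)
    have h1 := mem_sphere.1 hs; have h2 := mem_ball.1 hb
    exact absurd h1 (ne_of_lt h2)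
  -- heights of the chart along the line near `y₀` are strictly monotone in `t`
  -- (1) the plane chart is an edge chart; extract its squares
  obtain ⟨q₁, q₂, hedge⟩ : ∃ q₁ q₂ : Fin P.n × Fin P.n, (y₀ : ℝ × ℝ) ∈ sphere (P.gr.centre q₁) P.gr.ℓ ∧
      (∀ x ∈ ĉ.source, x.2 = c₀.2 → x ∈ sphere (P.gr.centre q₁) P.gr.ℓ ∧
        (ĉ x).2 = (P.datum ho).H q₁ x) := by
    rcases hĉ with ⟨q, h₁, k, rfl⟩ | ⟨q, h₁, k, rfl⟩ | ⟨q₁, q₂, T, hn, hr₁, hf₂, E, rfl⟩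
    · exact absurd ((P.datum ho).roofChart_source_subset h₁ k hy₀ĉ) (hy₀nb q)
    · exact absurd ((P.datum ho).floorChart_source_subset h₁ k hy₀ĉ) (hy₀nb q)
    · have hne : q₂ ≠ q₁ := fun h ↦ hf₂ (h ▸ hr₁)
      -- line points of the source are on the open edge
      have honedge : ∀ x ∈ E.chart.source, x.2 = c₀.2 → x ∈ openEdge (P.gr.centre q₁) (P.gr.centre q₂) P.gr.ℓ := by
        intro x hx hx2
        rcases E.source_subset hx with (hb | hb) | he'
        · have hs := P.mem_sphere_of_mem_sq_of_snd_eq heven (ball_subset_closedBall hb) hx2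
          exact absurd (mem_sphere.1 hs) (ne_of_lt (mem_ball.1 hb))
        · have hs := P.mem_sphere_of_mem_sq_of_snd_eq heven (ball_subset_closedBall hb) hx2
          exact absurd (mem_sphere.1 hs) (ne_of_lt (mem_ball.1 hb))
        · exact he'
      refine ⟨q₁, q₂, (honedge _ hy₀ĉ (by rw [hy₀eq]; simp)).1, fun x hx hx2 ↦ ⟨(honedge x hx hx2).1, ?_⟩⟩
      have hcanon : (E.chart x).2 = (if dist x (P.gr.centre q₁) ≤ P.gr.ℓ then (P.datum ho).H q₁ x
          else (P.datum ho).σ q₁ q₂ ((P.datum ho).H q₂ x)) := E.chart_snd_eq_canonHt hx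
      rw [hcanon, if_pos (le_of_eq (mem_sphere.1 (honedge x hx hx2).1))]
  -- (2) the ring square `q₁` is radial
  have hq₁R : (P.gr.sq q₁ ∩ sphere c₀ R).Nonempty :=
    ⟨_, P.gr.sphere_subset_sq q₁ hedge.1, mem_sphere.2 (by rw [← hptR, hptd, abs_of_pos hR0])⟩
  have hrad := P.isRadial_of_ring hΦ hcl hτI h01 hG hGc hn32 hskelT hR hq₁R
  have hmono := P.strictMonoOn_or_strictAntiOn_radialHt hΦ hτI h01 hG hGc (P.sq_subset_collar hn32 hR hq₁R)
  -- the `ĉ`-height of a line point of the source is the radial height at `|t|`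
  have hĉht : ∀ t, pt t ∈ ĉ.source → (ĉ (pt t)).2 = P.radialHt q₁ |t| ∧
      |t| ∈ Icc (dist (P.gr.centre q₁) c₀ - P.gr.ℓ) (dist (P.gr.centre q₁) c₀ + P.gr.ℓ) := by
    intro t ht
    obtain ⟨hs, hH⟩ := hedge.2 (pt t) ht (hpt2 t)
    refine ⟨?_, by rw [← hptd]; exact hrad.mem _ hs⟩
    rw [hH]
    show coneHt (P.gr.centre q₁) P.gr.ℓ (P.apex q₁) (P.bdryHt q₁) (pt t) = _
    rw [coneHt_of_mem_sphere hℓ hs, hrad.eq _ hs, hptd]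
  -- (3) line points near `R` are in the source of the atlas chart
  set dd := orientChart P.gr.planeEmb (renormBox (ĉ.subtypeRestr P.gr.nonempty_X₀) p r hr) with hdd
  set U : Set (ℝ × ℝ) := ((↑) : P.gr.X₀ → ℝ × ℝ) '' dd.source with hU
  have hUo : IsOpen U := P.gr.X₀.2.isOpenMap_subtype_val _ dd.open_source
  have hy₀U : pt R ∈ U := ⟨y₀, hy₀d, hptR.symm⟩
  have hev : ∀ᶠ t in 𝓝 R, pt t ∈ U ∧ 0 < t := by
    have h1 : ∀ᶠ t in 𝓝 R, pt t ∈ U := hptc.continuousAt.preimage_mem_nhds (hUo.mem_nhds hy₀U)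
    exact h1.and (lt_mem_nhds hR0)
  have hevL : ∀ᶠ t in 𝓝[<] R, (pt t ∈ U ∧ 0 < t) ∧ t < R :=
    (hev.filter_mono nhdsWithin_le_nhds).and (eventually_nhdsWithin_of_forall fun t ht ↦ ht)
  have hevR : ∀ᶠ t in 𝓝[>] R, (pt t ∈ U ∧ 0 < t) ∧ R < t :=
    (hev.filter_mono nhdsWithin_le_nhds).and (eventually_nhdsWithin_of_forall fun t ht ↦ ht)
  obtain ⟨tL, ⟨htLU, htL0⟩, htLR⟩ := hevL.exists
  obtain ⟨tR, ⟨htRU, -⟩, htRR⟩ := hevR.exists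
  have htLR' : tL < R := htLR
  have htRR' : R < tR := htRR
  obtain ⟨zL, hzLd, hzLeq⟩ := htLU
  obtain ⟨zR, hzRd, hzReq⟩ := htRU
  obtain ⟨hzLr, hzLĉ⟩ := hsrc zL hzLd
  obtain ⟨hzRr, hzRĉ⟩ := hsrc zR hzRd
  -- (4) the heights of `zL`, `y₀`, `zR` in the atlas chart
  have hsnd : ∀ z : P.gr.X₀, (dd z).2 = (renormBox (ĉ.subtypeRestr P.gr.nonempty_X₀) p r hr z).2 := fun z ↦ by
    rw [hdd, orientChart_snd]
  have hĉsub : ∀ z : P.gr.X₀, ((ĉ.subtypeRestr P.gr.nonempty_X₀) z).2 = (ĉ (z : ℝ × ℝ)).2 := fun z ↦ rfl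
  have hLval := hĉht tL (by rw [← hzLeq]; exact hzLĉ)
  have hRval := hĉht tR (by rw [← hzReq]; exact hzRĉ)
  have h0val := hĉht R (by rw [hptR]; exact hy₀ĉ)
  rw [abs_of_pos htL0] at hLval
  rw [abs_of_pos (hR0.trans htRR')] at hRval
  rw [abs_of_pos hR0] at h0val
  have hlt_iff : ∀ {z z' : P.gr.X₀}, z ∈ (renormBox (ĉ.subtypeRestr P.gr.nonempty_X₀) p r hr).source →
      z' ∈ (renormBox (ĉ.subtypeRestr P.gr.nonempty_X₀) p r hr).source →
      ((dd z).2 < (dd z').2 ↔ (ĉ (z : ℝ × ℝ)).2 < (ĉ (z' : ℝ × ℝ)).2) := fun {z z'} hz hz' ↦ by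
    rw [hsnd, hsnd, renormBox_snd_lt_iff hz hz']
    rfl
  have hzLpt : (zL : ℝ × ℝ) = pt tL := hzLeq
  have hzRpt : (zR : ℝ × ℝ) = pt tR := hzReq
  have hy₀pt : (y₀ : ℝ × ℝ) = pt R := hptR.symm
  -- images
  have hιL : ι zL = toCC (pt tL) := by rw [hιapp, hzLpt]
  have hιR : ι zR = toCC (pt tR) := by rw [hιapp, hzRpt]
  have hRout : ι zR ∈ outsideLeaf Fc ι y₀ := by rw [hιR]; exact hBout tR htRR'
  have hLoff : ι zL ∉ ι '' Fc.leaf y₀ := by rw [hιL]; exact hoff tL (by rw [abs_of_pos htL0]; exact htLR'.ne)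
  -- (5) `zL` is inner
  have hLin : ι zL ∈ insideLeaf Fc ι y₀ := by
    rcases hmono with hm | ha
    · -- increasing radial height: `zL` below, `zR` above
      have h1 : (dd zL).2 < (dd y₀).2 := by
        rw [hlt_iff hzLr hy₀r, hzLpt, hy₀pt, hLval.1, h0val.1]
        exact hm hLval.2 h0val.2 htLR'
      have h2 : (dd y₀).2 < (dd zR).2 := by
        rw [hlt_iff hy₀r hzRr, hzRpt, hy₀pt, hRval.1, h0val.1]
        exact hm h0val.2 hRval.2 htRR'
      exact (mem_insideLeaf_iff_mem_outsideLeaf_of_lt hbi hι hEc hdA (Fc.mem_leaf_self y₀) hy₀d hzLd hzRd h1 h2).2 hRout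
    · -- decreasing radial height: `zR` below, `zL` above
      have h1 : (dd zR).2 < (dd y₀).2 := by
        rw [hlt_iff hzRr hy₀r, hzRpt, hy₀pt, hRval.1, h0val.1]
        exact ha h0val.2 hRval.2 htRR'
      have h2 : (dd y₀).2 < (dd zL).2 := by
        rw [hlt_iff hy₀r hzLr, hzLpt, hy₀pt, hLval.1, h0val.1]
        exact ha hLval.2 h0val.2 htLR'
      have hiff := mem_insideLeaf_iff_mem_outsideLeaf_of_lt hbi hι hEc hdA (Fc.mem_leaf_self y₀) hy₀d hzRd hzLd h1 h2
      have hRnot : ι zR ∉ insideLeaf Fc ι y₀ := fun h ↦ disjoint_left.1 (disjoint_insideLeaf_outsideLeaf y₀) h hRout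
      rcases mem_insideLeaf_or_mem_outsideLeaf hLoff with h | h
      · exact h
      · exact absurd (hiff.2 h) hRnot
  -- (6) the segment through `c₀` is inner
  have hAc : IsPreconnected (toCC ∘ pt '' Ioo (-R) R) := isPreconnected_Ioo.image _ (htoCCc.comp hptc).continuousOn
  have hAK : Disjoint (toCC ∘ pt '' Ioo (-R) R) (ι '' Fc.leaf y₀) := disjoint_left.2 (by
    rintro _ ⟨t, ht, rfl⟩ h
    exact hoff t (fun habs ↦ by rcases (abs_eq hR0.le).1 habs with h' | h' <;> [linarith [ht.2]; linarith [ht.1]]) h)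
  have htLmem : tL ∈ Ioo (-R) R := ⟨by linarith, htLR'⟩
  have hsub := subset_insideLeaf_of_isPreconnected hbi hι hEc hAc hAK
    ⟨_, ⟨tL, htLmem, rfl⟩, by show toCC (pt tL) ∈ _; rw [← hιL]; exact hLin⟩
  have h0 : toCC (pt 0) ∈ insideLeaf Fc ι y₀ := hsub ⟨0, ⟨by linarith, hR0⟩, rfl⟩
  rw [hpt0] at h0
  exact h0

end Foliation.ConePosition

end Literature.Topology.FourManifolds
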